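import Summits.HodgeConjecture.CorCM.Census.CentralSquaresOrbitLaw
import Summits.HodgeConjecture.CorCM.Census.CentralSquaresChosenCover

/-!
# The square-central class, XXXVIII: THE ORBIT FRAME LAW at `m = 4` — `μ(G, c) = φ₂(G, c)` from ONE prescribed orbit face

COR-CM (cell `pub-hodgecm2`), count-neutral kernel combinatorics by the binder seat b09 (gen 47; lane SQUARE-CENTRAL CLASS, part XXXVIII), assembling
part XXXVII (`orbit_consecutive_sums`, `orbit_consecutive_sums_companion`, `residual_closure_orbit_four`) and part XIII (`exists_admissible_choice`,
`isLeast_card_gfaces_generate_of_chosen_cover_closure`) BY NAME, after part XXIʼs pattern (`m = 2`).  Theorems only: no definition, no `decide`, no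
certificate, no named fact, no `sorry`.  HONEST FRAMING: `HC_CM` is NOT proved, here or anywhere in the tree; nothing here is a period or a headline.

* §1 `ddist_orbit_type` (`|T| = |A| = m`: the orbit type `{T ∣ A}` is at distance `2m` from all four base changes), `not_strict_orbit_type`,
  `not_strict_rt_orbit_type` (no base change of it carries a strict lowering triple — every single flip is a two-way tie), `cycle_stable`
  (a `4`-cycle of the place permutation is stable under the swap, in the `iff` form of part III).
* §2 **`isLeast_card_gfaces_generate_orbit_four`** — THE ORBIT FRAME LAW.  `G` a finite `2`-group, `c` a central involution `≠ 1`; the four-type frame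
  `(T₀; T₁)` with `|T₀| = 16`, `|𝓗| = 8`; two base-involutive swaps `Q`, `Q'` (`T₀ ↦ T₁ ↦ T₀`) preserving `𝓗`; a `Q`-transversal `T ⊆ 𝓗` and a
  `Q'`-transversal `A' ⊆ T₀ ∩ T₁` of size `4`; a `4`-cycle `a₀ → a₁ → a₂ → a₃ → a₀` of the place permutation of `Q` in `T₀ ∩ T₁` and the orbit type
  `Φ = {T ∣ a₀,a₁,a₂,a₃}`.  HYPOTHESIS `hcomp` (discharged by the instance, part XXXIX, through `K`- and `g₁`-translates): every base-change stable
  lattice containing the face of `Φ` at `a₀, a₁` contains, for every `k ∈ T₀ ∩ T₁`, the designated face of the orbit type `{T ∣ C}` of a `4`-cycle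
  `C ∋ k` of `Q`, and for every `h ∈ 𝓗` the designated face of the companion orbit type `{A' ∣ B}` of a `4`-cycle `B ∋ h` of `Q'`.  Then
  **`μ(G, c) = φ₂(G, c)`**: prescribe the face of `Φ` at one block (admissible: `Φ` carries no strict triple), and for every strict lowering cover
  containing it parts XXXVII + XXIV close the residual lattice up to `4`.

## References
* [Pohlmann1968] H. Pohlmann, Algebraic cycles on abelian varieties of complex multiplication type, Ann. of Math. 88 (1968), Thm 1.
* [Milne1999] J. S. Milne, Lefschetz motives and the Tate conjecture, Compositio Math. 117 (1999), Prop. 2.1, p. 54.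
-/

namespace Summit.HodgeConjecture.CorCM.Census.CentralSquares

open Finset
open scoped symmDiff
open Summit.HodgeConjecture.CorCM.Prior.AllgGroup.RfwfAllgGroup
open Summit.HodgeConjecture.CorCM.Census.BlockParity
open Summit.HodgeConjecture.CorCM.Census.Coinvariant
open Summit.HodgeConjecture.CorCM.Census.TwistGeneration
open Summit.HodgeConjecture.CorCM.Census.BaseBlock
open Summit.HodgeConjecture.CorCM.Census.CoverClosure

noncomputable section

variable {G : Type*} [Group G] [Fintype G] [DecidableEq G] (c : G)

section Frame

variable (hc2 : c * c = 1) (hcen : ∀ x : G, x * c = c * x) (T₀ T₁ : CMF G c)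
variable (hbase : ∀ Q : G, rt c Q T₀ = T₀ ∨ rt c Q T₀ = rt c c T₀ ∨ rt c Q T₀ = T₁ ∨ rt c Q T₀ = rt c c T₁)
variable (m : ℕ) (hn : T₀.1.card = 4 * m) (hH : (T₀.1 \ T₁.1).card = 2 * m)

/-! ## §1 The orbit type: a four-way tie without strict triples; cycles are stable -/

include hc2 hcen hbase hn hH in
/-- **The orbit type is at distance `2m` from all four base changes** (`D(Φ) = T ∪ A`, `T ⊆ 𝓗`, `A ⊆ T₀ ∖ 𝓗`, `|T| = |A| = m`), so `bpot Φ = 2m`.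
[folklore] -/
theorem ddist_orbit_type (T A : Finset G) (hTH : T ⊆ T₀.1 \ T₁.1) (hTm : T.card = m) (hA : A ⊆ T₀.1 \ (T₀.1 \ T₁.1)) (hAm : A.card = m)
    (Φ : CMF G c) (hΦ : T₀.1 \ Φ.1 = T ∪ A) :
    bpot c T₀ Φ = 2 * m ∧ ∀ Q' : G, ddist (rt c Q' T₀) Φ = 2 * m := by
  have hAH : Disjoint A (T₀.1 \ T₁.1) := by
    rw [disjoint_iff_ne]; rintro x hx y hy rfl; exact (mem_sdiff.mp (hA hx)).2 hy
  have hTA : Disjoint T A := by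
    rw [disjoint_iff_ne]; rintro x hx y hy rfl; exact (mem_sdiff.mp (hA hy)).2 (hTH hx)
  have hD : (T₀.1 \ Φ.1).card = 2 * m := by rw [hΦ, card_union_of_disjoint hTA, hTm, hAm]; omega
  have hsd : ((T₀.1 \ T₁.1) ∆ (T₀.1 \ Φ.1)).card = 2 * m := by rw [hΦ, card_symmDiff_union _ T A hTH hAH, hH, hTm, hAm]; omega
  have hall : ∀ Q' : G, ddist (rt c Q' T₀) Φ = 2 * m := by
    intro Q'
    rcases hbase Q' with h | h | h | h <;> rw [h]
    · rw [ddist_base_eq, hD]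
    · rw [ddist_compl_base_eq c T₀ hc2 hcen, hD, hn]; omega
    · rw [ddist_eq_card_symmDiff c T₀ hc2, hsd]
    · rw [ddist_compl_eq c T₀ hc2 hcen, hsd, hn]; omega
  refine ⟨?_, hall⟩
  obtain ⟨Q', hQ'⟩ := exists_bpot_eq c T₀ Φ
  rw [hQ', hall]

include hc2 hcen hbase hn hH in
/-- **The orbit type carries NO strict lowering triple** (`m ≥ 1`): after any single flip the nearest base change is attained twice. [folklore] -/
theorem not_strict_orbit_type (hm : 1 ≤ m) (T A : Finset G) (hTH : T ⊆ T₀.1 \ T₁.1) (hTm : T.card = m)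
    (hA : A ⊆ T₀.1 \ (T₀.1 \ T₁.1)) (hAm : A.card = m) (Φ : CMF G c) (hΦ : T₀.1 \ Φ.1 = T ∪ A) {Q : G} (hQ : rt c Q T₀ = T₁) :
    ¬ ∃ Q₁ x x' : G, bpot c T₀ Φ = ddist (rt c Q₁ T₀) Φ ∧ x ∈ (rt c Q₁ T₀).1 \ Φ.1 ∧
      x' ∈ (rt c Q₁ T₀).1 \ Φ.1 ∧ x ≠ x' ∧
      (∀ Q' : G, ddist (rt c Q' T₀) (oflipCM c hc2 x Φ) = bpot c T₀ (oflipCM c hc2 x Φ) → rt c Q' T₀ = rt c Q₁ T₀) ∧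
      (∀ Q' : G, ddist (rt c Q' T₀) (oflipCM c hc2 x' Φ) = bpot c T₀ (oflipCM c hc2 x' Φ) → rt c Q' T₀ = rt c Q₁ T₀) ∧
      (∀ Q' : G, ddist (rt c Q' T₀) (oflipCM c hc2 x (oflipCM c hc2 x' Φ)) = bpot c T₀ (oflipCM c hc2 x (oflipCM c hc2 x' Φ)) →
        rt c Q' T₀ = rt c Q₁ T₀) := by
  obtain ⟨-, hall⟩ := ddist_orbit_type c hc2 hcen T₀ T₁ hbase m hn hH T A hTH hTm hA hAm Φ hΦ
  rintro ⟨Q₁, x, x', -, hx, -, -, hu1, -, -⟩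
  have h3 : ddist (rt c Q₁ T₀) (oflipCM c hc2 x Φ) = 2 * m - 1 := by
    have h := ddist_oflipCM_of_mem_sdiff hc2 hx; rw [hall] at h; omega
  have hb3 : bpot c T₀ (oflipCM c hc2 x Φ) = 2 * m - 1 := by
    obtain ⟨Q', hQ'⟩ := exists_bpot_eq c T₀ (oflipCM c hc2 x Φ)
    rw [hQ', hu1 Q' hQ'.symm, h3]
  have key : ∀ Q' : G, ddist (rt c Q' T₀) (oflipCM c hc2 x Φ) = 2 * m - 1 → rt c Q' T₀ = rt c Q₁ T₀ := fun Q' h => hu1 Q' (by rw [h, hb3])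
  have hpm : ∀ Q' : G, ddist (rt c Q' T₀) (oflipCM c hc2 x Φ) = 2 * m - 1 ∨ ddist (rt c Q' T₀) (oflipCM c hc2 x Φ) = 2 * m + 1 := by
    intro Q'
    rcases ddist_oflipCM_pm c hc2 (rt c Q' T₀) Φ x with h | h <;> rw [hall] at h <;> omega
  have h0 : ddist (rt c 1 T₀) (oflipCM c hc2 x Φ) = 2 * m - 1 ∨ ddist (rt c c T₀) (oflipCM c hc2 x Φ) = 2 * m - 1 := by
    have e0 := ddist_base_eq c T₀ (oflipCM c hc2 x Φ)
    have e0' := ddist_compl_base_eq c T₀ hc2 hcen (oflipCM c hc2 x Φ)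
    have hDle : (T₀.1 \ (oflipCM c hc2 x Φ).1).card ≤ T₀.1.card := card_le_card sdiff_subset
    rw [rt_one]
    rcases hpm 1 with h | h
    · left; rwa [rt_one] at h
    · right; rw [rt_one] at h; omega
  have h1 : ddist (rt c Q T₀) (oflipCM c hc2 x Φ) = 2 * m - 1 ∨ ddist (rt c (c * Q) T₀) (oflipCM c hc2 x Φ) = 2 * m - 1 := by
    have e1 := ddist_eq_card_symmDiff c T₀ hc2 T₁ (oflipCM c hc2 x Φ)
    have e1' := ddist_compl_eq c T₀ hc2 hcen T₁ (oflipCM c hc2 x Φ)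
    have hSle : ((T₀.1 \ T₁.1) ∆ (T₀.1 \ (oflipCM c hc2 x Φ).1)).card ≤ T₀.1.card := by
      apply card_le_card; intro y hy; rw [mem_symmDiff] at hy
      rcases hy with ⟨h, -⟩ | ⟨h, -⟩
      · exact (mem_sdiff.mp h).1
      · exact (mem_sdiff.mp h).1
    rw [rt_mul, hQ]
    rcases hpm Q with h | h
    · left; rw [hQ] at h; exact h
    · right; rw [hQ] at h; omega
  -- two distinct nearest base changes
  have hne01 : T₀ ≠ T₁ := by
    intro h; rw [← h, Finset.sdiff_self, Finset.card_empty] at hH; omega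
  have hHc : (T₀.1 ∩ T₁.1).Nonempty := by
    apply card_pos.mp; have h0 := card_sdiff_add_card_inter T₀.1 T₁.1; omega
  have hne01' : T₀ ≠ rt c c T₁ := by
    intro h; obtain ⟨y, hy⟩ := hHc
    have hy' : y ∈ (rt c c T₁).1 := h ▸ (mem_inter.mp hy).1
    rw [rt_self_val c hcen, mem_sdiff] at hy'
    exact hy'.2 (mem_inter.mp hy).2
  have hne0'1 : rt c c T₀ ≠ T₁ := by
    intro h; obtain ⟨y, hy⟩ := hHc
    have hy' : y ∈ (rt c c T₀).1 := h.symm ▸ (mem_inter.mp hy).2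
    rw [rt_self_val c hcen, mem_sdiff] at hy'
    exact hy'.2 (mem_inter.mp hy).1
  have hne0'1' : rt c c T₀ ≠ rt c c T₁ := fun h => hne01 ((rt_bijective c c).1 h)
  rcases h0 with h0 | h0 <;> rcases h1 with h1 | h1
  · exact hne01 (by rw [← rt_one c T₀, key 1 h0, ← hQ, key Q h1])
  · exact hne01' (by rw [← rt_one c T₀, key 1 h0, ← hQ, ← rt_mul, key (c * Q) h1])
  · exact hne0'1 (by rw [key c h0, ← hQ, key Q h1])
  · exact hne0'1' (by rw [key c h0, ← hQ, ← rt_mul, key (c * Q) h1])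

include hc2 hcen hbase hn hH in
/-- **No base change of the orbit type carries a strict lowering triple** (transport by part Iʼs `strict_rt`). [folklore] -/
theorem not_strict_rt_orbit_type (hm : 1 ≤ m) (T A : Finset G) (hTH : T ⊆ T₀.1 \ T₁.1) (hTm : T.card = m)
    (hA : A ⊆ T₀.1 \ (T₀.1 \ T₁.1)) (hAm : A.card = m) (Φ : CMF G c) (hΦ : T₀.1 \ Φ.1 = T ∪ A) {Q : G} (hQ : rt c Q T₀ = T₁) (g : G) :
    ¬ ∃ Q₁ x x' : G, bpot c T₀ (rt c g Φ) = ddist (rt c Q₁ T₀) (rt c g Φ) ∧ x ∈ (rt c Q₁ T₀).1 \ (rt c g Φ).1 ∧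
      x' ∈ (rt c Q₁ T₀).1 \ (rt c g Φ).1 ∧ x ≠ x' ∧
      (∀ Q' : G, ddist (rt c Q' T₀) (oflipCM c hc2 x (rt c g Φ)) = bpot c T₀ (oflipCM c hc2 x (rt c g Φ)) → rt c Q' T₀ = rt c Q₁ T₀) ∧
      (∀ Q' : G, ddist (rt c Q' T₀) (oflipCM c hc2 x' (rt c g Φ)) = bpot c T₀ (oflipCM c hc2 x' (rt c g Φ)) → rt c Q' T₀ = rt c Q₁ T₀) ∧
      (∀ Q' : G, ddist (rt c Q' T₀) (oflipCM c hc2 x (oflipCM c hc2 x' (rt c g Φ))) = bpot c T₀ (oflipCM c hc2 x (oflipCM c hc2 x' (rt c g Φ))) →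
        rt c Q' T₀ = rt c Q₁ T₀) := by
  rintro ⟨Q₁, x, x', h1, hx, hx', hxx', hu1, hu2, hu3⟩
  obtain ⟨k1, kx, kx', kxx', ku1, ku2, ku3⟩ := strict_rt c T₀ hc2 g⁻¹ h1 hx hx' hxx' hu1 hu2 hu3
  rw [rt_inv_rt] at k1 kx kx' ku1 ku2 ku3
  exact not_strict_orbit_type c hc2 hcen T₀ T₁ hbase m hn hH hm T A hTH hTm hA hAm Φ hΦ hQ ⟨_, _, _, k1, kx, kx', kxx', ku1, ku2, ku3⟩

include hc2 in
/-- **A `4`-cycle of the place permutation is stable under the swap** (`iff` form on representatives): for `t` in the ambient set and a representative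
`t'` of the place of `t·Q`, `t ∈ {a₀, a₁, a₂, a₃} ↔ t' ∈ {a₀, a₁, a₂, a₃}`. [folklore] -/
theorem cycle_stable (Q : G) (H : Finset G) (hHT₀ : H ⊆ T₀.1) {a₀ a₁ a₂ a₃ : G} (ha₀ : a₀ ∈ H) (ha₁ : a₁ ∈ H) (ha₂ : a₂ ∈ H) (ha₃ : a₃ ∈ H)
    (r₀ : a₁ = a₀ * Q ∨ a₁ = c * (a₀ * Q)) (r₁ : a₂ = a₁ * Q ∨ a₂ = c * (a₁ * Q)) (r₂ : a₃ = a₂ * Q ∨ a₃ = c * (a₂ * Q))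
    (r₃ : a₀ = a₃ * Q ∨ a₀ = c * (a₃ * Q)) :
    ∀ t ∈ H, ∀ t' ∈ T₀.1, (t' = t * Q ∨ t' = c * (t * Q)) → (t ∈ ({a₀, a₁, a₂, a₃} : Finset G) ↔ t' ∈ ({a₀, a₁, a₂, a₃} : Finset G)) := by
  intro t ht t' ht' h
  simp only [mem_insert, mem_singleton]
  constructor
  · rintro (rfl | rfl | rfl | rfl)
    · exact Or.inr (Or.inl (rep_eq_of_rel c T₀ ht' (hHT₀ ha₁) h r₀))
    · exact Or.inr (Or.inr (Or.inl (rep_eq_of_rel c T₀ ht' (hHT₀ ha₂) h r₁)))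
    · exact Or.inr (Or.inr (Or.inr (rep_eq_of_rel c T₀ ht' (hHT₀ ha₃) h r₂)))
    · exact Or.inl (rep_eq_of_rel c T₀ ht' (hHT₀ ha₀) h r₃)
  · rintro (rfl | rfl | rfl | rfl)
    · exact Or.inr (Or.inr (Or.inr (eq_of_swap_rel_eq c hc2 T₀ Q (hHT₀ ht) (hHT₀ ha₃) h r₃)))
    · exact Or.inl (eq_of_swap_rel_eq c hc2 T₀ Q (hHT₀ ht) (hHT₀ ha₀) h r₀)
    · exact Or.inr (Or.inl (eq_of_swap_rel_eq c hc2 T₀ Q (hHT₀ ht) (hHT₀ ha₁) h r₁))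
    · exact Or.inr (Or.inr (Or.inl (eq_of_swap_rel_eq c hc2 T₀ Q (hHT₀ ht) (hHT₀ ha₂) h r₂)))

/-! ## §2 THE ORBIT FRAME LAW -/

include hc2 hcen hbase hn hH in
/-- **THE ORBIT FRAME LAW (`m = 4`).**  `G` a finite `2`-group, `c` a central involution `≠ 1`; the four-type frame `(T₀; T₁)` with `|T₀| = 16`,
`|𝓗| = 8`; base-involutive swaps `Q`, `Q'` (`T₀·Q⁻¹ = T₁`, `T₁·Q⁻¹ = T₀`, likewise for `Q'`) whose place permutations preserve `𝓗`; a `Q`-transversal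
`T ⊆ 𝓗` and a `Q'`-transversal `A' ⊆ T₀ ∩ T₁` of size `4`; a `4`-cycle `a₀ → a₁ → a₂ → a₃ → a₀` of the place permutation of `Q` inside `T₀ ∩ T₁`
and the orbit type `Φ` with `D(Φ) = T ∪ {a₀, a₁, a₂, a₃}`.  Suppose (`hcomp`) that every base-change stable lattice containing the face of `Φ` at
`a₀, a₁` contains, for every `k ∈ T₀ ∩ T₁`, the face at the first two places of a `4`-cycle `k₀ → k₁ → k₂ → k₃` of `Q` through `k` inside `T₀ ∩ T₁` of
the type with deviation set `T ∪ {k₀, …, k₃}`, and for every `h ∈ 𝓗` the face at the first two places of a `4`-cycle `b₀ → … → b₃` of `Q'` through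
`h` inside `𝓗` of the type with deviation set `A' ∪ {b₀, …, b₃}`.  Then **`μ(G, c) = φ₂(G, c)`**: the least number of faces whose base changes together
with the pairs generate the Hodge lattice is the coinvariant fibre. [folklore] -/
theorem isLeast_card_gfaces_generate_orbit_four (hG : IsPGroup 2 G) (hc1 : c ≠ 1) (hm : m = 4)
    (Q : G) (hQ : rt c Q T₀ = T₁) (hQ₁ : rt c Q T₁ = T₀)
    (hσH : ∀ t ∈ T₀.1, ∀ t' ∈ T₀.1, (t' = t * Q ∨ t' = c * (t * Q)) → (t ∈ T₀.1 \ T₁.1 ↔ t' ∈ T₀.1 \ T₁.1))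
    (Q' : G) (hQ' : rt c Q' T₀ = T₁) (hQ'₁ : rt c Q' T₁ = T₀)
    (hσH' : ∀ t ∈ T₀.1, ∀ t' ∈ T₀.1, (t' = t * Q' ∨ t' = c * (t * Q')) → (t ∈ T₀.1 \ T₁.1 ↔ t' ∈ T₀.1 \ T₁.1))
    (T : Finset G) (hTH : T ⊆ T₀.1 \ T₁.1) (hTm : T.card = m)
    (hT : ∀ t ∈ T₀.1 \ T₁.1, ∀ t' ∈ T₀.1, (t' = t * Q ∨ t' = c * (t * Q)) → (t ∈ T ↔ t' ∉ T))
    (hTQ' : ∀ t ∈ T₀.1 \ T₁.1, ∀ t' ∈ T₀.1, (t' = t * Q' ∨ t' = c * (t * Q')) → (t ∈ T ↔ t' ∉ T))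
    (A' : Finset G) (hA'H : A' ⊆ T₀.1 ∩ T₁.1) (hA'm : A'.card = m)
    (hA't : ∀ t ∈ T₀.1 ∩ T₁.1, ∀ t' ∈ T₀.1, (t' = t * Q' ∨ t' = c * (t * Q')) → (t ∈ A' ↔ t' ∉ A'))
    (hA'Q : ∀ t ∈ T₀.1 ∩ T₁.1, ∀ t' ∈ T₀.1, (t' = t * Q ∨ t' = c * (t * Q)) → (t ∈ A' ↔ t' ∉ A'))
    {a₀ a₁ a₂ a₃ : G} (ha₀ : a₀ ∈ T₀.1 ∩ T₁.1) (ha₁ : a₁ ∈ T₀.1 ∩ T₁.1) (ha₂ : a₂ ∈ T₀.1 ∩ T₁.1) (ha₃ : a₃ ∈ T₀.1 ∩ T₁.1)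
    (hra : (a₁ = a₀ * Q ∨ a₁ = c * (a₀ * Q)) ∧ (a₂ = a₁ * Q ∨ a₂ = c * (a₁ * Q)) ∧
        (a₃ = a₂ * Q ∨ a₃ = c * (a₂ * Q)) ∧ (a₀ = a₃ * Q ∨ a₀ = c * (a₃ * Q)) ∧
        a₀ ≠ a₁ ∧ a₁ ≠ a₂ ∧ a₂ ≠ a₃ ∧ a₃ ≠ a₀ ∧ a₀ ≠ a₂ ∧ a₁ ≠ a₃)
    (Φ : CMF G c) (hΦ : T₀.1 \ Φ.1 = T ∪ {a₀, a₁, a₂, a₃})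
    (hcomp : ∀ L : Submodule ℤ (CMF G c →₀ ℤ), (∀ (R : G) (y : CMF G c →₀ ℤ), y ∈ L → Finsupp.mapDomain (rt c R) y ∈ L) →
      gface c hc2 Φ a₀ a₁ ∈ L →
      (∀ k ∈ T₀.1 ∩ T₁.1, ∃ k₀ k₁ k₂ k₃ : G, ∃ Φ' : CMF G c, k₀ ∈ T₀.1 ∩ T₁.1 ∧ k₁ ∈ T₀.1 ∩ T₁.1 ∧ k₂ ∈ T₀.1 ∩ T₁.1 ∧ k₃ ∈ T₀.1 ∩ T₁.1 ∧
        (k = k₀ ∨ k = k₁ ∨ k = k₂ ∨ k = k₃) ∧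
        (k₁ = k₀ * Q ∨ k₁ = c * (k₀ * Q)) ∧ (k₂ = k₁ * Q ∨ k₂ = c * (k₁ * Q)) ∧
        (k₃ = k₂ * Q ∨ k₃ = c * (k₂ * Q)) ∧ (k₀ = k₃ * Q ∨ k₀ = c * (k₃ * Q)) ∧
        k₀ ≠ k₁ ∧ k₁ ≠ k₂ ∧ k₂ ≠ k₃ ∧ k₃ ≠ k₀ ∧ k₀ ≠ k₂ ∧ k₁ ≠ k₃ ∧
        T₀.1 \ Φ'.1 = T ∪ {k₀, k₁, k₂, k₃} ∧ gface c hc2 Φ' k₀ k₁ ∈ L) ∧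
      (∀ h ∈ T₀.1 \ T₁.1, ∃ b₀ b₁ b₂ b₃ : G, ∃ Ψ : CMF G c, b₀ ∈ T₀.1 \ T₁.1 ∧ b₁ ∈ T₀.1 \ T₁.1 ∧ b₂ ∈ T₀.1 \ T₁.1 ∧ b₃ ∈ T₀.1 \ T₁.1 ∧
        (h = b₀ ∨ h = b₁ ∨ h = b₂ ∨ h = b₃) ∧
        (b₁ = b₀ * Q' ∨ b₁ = c * (b₀ * Q')) ∧ (b₂ = b₁ * Q' ∨ b₂ = c * (b₁ * Q')) ∧
        (b₃ = b₂ * Q' ∨ b₃ = c * (b₂ * Q')) ∧ (b₀ = b₃ * Q' ∨ b₀ = c * (b₃ * Q')) ∧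
        b₀ ≠ b₁ ∧ b₁ ≠ b₂ ∧ b₂ ≠ b₃ ∧ b₃ ≠ b₀ ∧ b₀ ≠ b₂ ∧ b₁ ≠ b₃ ∧
        T₀.1 \ Ψ.1 = A' ∪ {b₀, b₁, b₂, b₃} ∧ gface c hc2 Ψ b₀ b₁ ∈ L)) :
    IsLeast {n : ℕ | ∃ S : Finset (CMF G c →₀ ℤ), (↑S ⊆ gfaceSet G c hc2) ∧ S.card = n ∧
      hodgeSpan c hc2 ≤ Submodule.span ℤ (pairSet c) ⊔ Submodule.span ℤ (translates c S)} (fibreTwo c hc2) := by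
  subst hm
  obtain ⟨r₀, r₁, r₂, r₃, h01, h12, h23, h30, h02, h13⟩ := hra
  have hHcT₀ : T₀.1 ∩ T₁.1 ⊆ T₀.1 := inter_subset_left
  have hHT₀ : T₀.1 \ T₁.1 ⊆ T₀.1 := sdiff_subset
  have hHc_eq : T₀.1 \ (T₀.1 \ T₁.1) = T₀.1 ∩ T₁.1 := sdiff_sdiff_self_left _ _
  have hAsub : ({a₀, a₁, a₂, a₃} : Finset G) ⊆ T₀.1 \ (T₀.1 \ T₁.1) := by
    rw [hHc_eq]; intro x hx; simp only [mem_insert, mem_singleton] at hx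
    rcases hx with rfl | rfl | rfl | rfl <;> assumption
  have hA4 : ({a₀, a₁, a₂, a₃} : Finset G).card = 4 := by
    rw [card_insert_of_notMem, card_insert_of_notMem, card_pair h23]
    · rw [mem_insert, mem_singleton, not_or]; exact ⟨h12, h13⟩
    · rw [mem_insert, mem_insert, mem_singleton, not_or, not_or]; exact ⟨h01, h02, h30.symm⟩
  have ha₀A : a₀ ∈ ({a₀, a₁, a₂, a₃} : Finset G) := by simp
  have ha₁A : a₁ ∈ ({a₀, a₁, a₂, a₃} : Finset G) := by simp
  have ha₀Φ : a₀ ∈ T₀.1 \ Φ.1 := by rw [hΦ]; exact mem_union_right _ ha₀A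
  have ha₁Φ : a₁ ∈ T₀.1 \ Φ.1 := by rw [hΦ]; exact mem_union_right _ ha₁A
  -- the block of the orbit type and the prescribed face at its representative
  obtain ⟨hb8, hall⟩ := ddist_orbit_type c hc2 hcen T₀ T₁ hbase 4 hn hH T {a₀, a₁, a₂, a₃} hTH hTm hAsub hA4 Φ hΦ
  obtain ⟨g, hg⟩ : ∃ g : G, rt c g Φ = (blk c Φ).out := exists_rt_eq_of_blk_eq c (blk_out c (blk c Φ)).symm
  have hlow₀ : bpot c T₀ (blk c Φ).out = ddist (rt c g T₀) (blk c Φ).out ∧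
      a₀ * g⁻¹ ∈ (rt c g T₀).1 \ ((blk c Φ).out).1 ∧ a₁ * g⁻¹ ∈ (rt c g T₀).1 \ ((blk c Φ).out).1 ∧ a₀ * g⁻¹ ≠ a₁ * g⁻¹ := by
    rw [← hg, bpot_rt, ddist_rt, hb8, mem_sdiff_rt_iff, mem_sdiff_rt_iff, inv_mul_cancel_right, inv_mul_cancel_right]
    refine ⟨?_, ha₀Φ, ha₁Φ, fun h => h01 (mul_right_cancel h)⟩
    have h := hall 1; rw [rt_one] at h; exact h.symm
  have h₀ns := not_strict_rt_orbit_type c hc2 hcen T₀ T₁ hbase 4 hn hH (by omega) T {a₀, a₁, a₂, a₃} hTH hTm hAsub hA4 Φ hΦ hQ g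
  rw [hg] at h₀ns
  obtain ⟨τ, hτ₀, hτlow, hτstr⟩ := exists_admissible_choice c T₀ hc2 (blk c Φ) (g, a₀ * g⁻¹, a₁ * g⁻¹) hlow₀ h₀ns
  refine isLeast_card_gfaces_generate_of_chosen_cover_closure c T₀ hG hc2 hc1 hcen 2 τ hτlow hτstr fun S hS hmem hlow => ?_
  -- the lattice of a strict cover containing the chosen face
  have hP : ∀ Ψ : CMF G c, pair c Ψ ∈ Submodule.span ℤ (pairSet c) ⊔ Submodule.span ℤ (translates c S) :=
    fun Ψ => Submodule.mem_sup_left (Submodule.subset_span (pair_mem_pairSet c Ψ))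
  have hLrt : ∀ (Q'' : G) (y : CMF G c →₀ ℤ), y ∈ Submodule.span ℤ (pairSet c) ⊔ Submodule.span ℤ (translates c S) →
      Finsupp.mapDomain (rt c Q'') y ∈ Submodule.span ℤ (pairSet c) ⊔ Submodule.span ℤ (translates c S) :=
    fun Q'' y hy => mapDomain_rt_mem_psp c hcen Q'' S hy
  have hcover : ∀ Ψ : CMF G c, 2 ≤ bpot c T₀ Ψ → ∃ Q₃ x x' : G, bpot c T₀ Ψ = ddist (rt c Q₃ T₀) Ψ ∧
      x ∈ (rt c Q₃ T₀).1 \ Ψ.1 ∧ x' ∈ (rt c Q₃ T₀).1 \ Ψ.1 ∧ x ≠ x' ∧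
      gface c hc2 Ψ x x' ∈ Submodule.span ℤ (pairSet c) ⊔ Submodule.span ℤ (translates c S) ∧
      ((∃ Q₁ y y' : G, bpot c T₀ Ψ = ddist (rt c Q₁ T₀) Ψ ∧ y ∈ (rt c Q₁ T₀).1 \ Ψ.1 ∧ y' ∈ (rt c Q₁ T₀).1 \ Ψ.1 ∧ y ≠ y' ∧
          (∀ Q' : G, ddist (rt c Q' T₀) (oflipCM c hc2 y Ψ) = bpot c T₀ (oflipCM c hc2 y Ψ) → rt c Q' T₀ = rt c Q₁ T₀) ∧
          (∀ Q' : G, ddist (rt c Q' T₀) (oflipCM c hc2 y' Ψ) = bpot c T₀ (oflipCM c hc2 y' Ψ) → rt c Q' T₀ = rt c Q₁ T₀) ∧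
          (∀ Q' : G, ddist (rt c Q' T₀) (oflipCM c hc2 y (oflipCM c hc2 y' Ψ)) = bpot c T₀ (oflipCM c hc2 y (oflipCM c hc2 y' Ψ)) →
            rt c Q' T₀ = rt c Q₁ T₀)) →
        (∀ Q' : G, ddist (rt c Q' T₀) (oflipCM c hc2 x Ψ) = bpot c T₀ (oflipCM c hc2 x Ψ) → rt c Q' T₀ = rt c Q₃ T₀) ∧
        (∀ Q' : G, ddist (rt c Q' T₀) (oflipCM c hc2 x' Ψ) = bpot c T₀ (oflipCM c hc2 x' Ψ) → rt c Q' T₀ = rt c Q₃ T₀) ∧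
        (∀ Q' : G, ddist (rt c Q' T₀) (oflipCM c hc2 x (oflipCM c hc2 x' Ψ)) = bpot c T₀ (oflipCM c hc2 x (oflipCM c hc2 x' Ψ)) →
          rt c Q' T₀ = rt c Q₃ T₀)) := by
    intro Ψ h2
    obtain ⟨Q₃, x, x', hQ₃, hx, hx', hxx', hxmem, hstr⟩ := hlow Ψ h2
    exact ⟨Q₃, x, x', hQ₃, hx, hx', hxx', Submodule.mem_sup_right hxmem, hstr⟩
  -- the prescribed face lies in the lattice
  have hF : gface c hc2 Φ a₀ a₁ ∈ Submodule.span ℤ (pairSet c) ⊔ Submodule.span ℤ (translates c S) := by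
    have h2 : 2 ≤ bpot c T₀ (blk c Φ).out := by rw [bpot_out, hb8]; omega
    have hS' := hmem (blk c Φ) h2
    rw [hτ₀, ← hg] at hS'
    have hS'' : gface c hc2 (rt c g Φ) (a₀ * g⁻¹) (a₁ * g⁻¹) ∈ translates c S :=
      ⟨1, _, hS', by rw [show rt c (1 : G) = id from funext (rt_one c), Finsupp.mapDomain_id]⟩
    have h := hLrt g⁻¹ _ (Submodule.mem_sup_right (Submodule.subset_span hS''))
    rwa [mapDomain_rt_gface, rt_inv_rt, inv_inv, inv_mul_cancel_right, inv_mul_cancel_right] at h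
  obtain ⟨hC, hHd⟩ := hcomp _ hLrt hF
  -- `R(T) ∈ L`
  have hR := rel_transversal_mem' c hc2 hcen T₀ T₁ hbase 4 hn hH Q hQ hQ₁ hσH _ hLrt hcover T hTH hTm hT (by omega)
  refine residual_closure_orbit_four c hc2 hcen T₀ T₁ hbase 4 hn hH Q hQ hQ₁ hσH _ hLrt hcover hc1 hP (by omega) Q' hQ' hQ'₁ hσH'
    ⟨T, hTH, hTm, hTQ'⟩ ⟨A', hA'H, hA'm, hA'Q⟩ ?_ ?_
  · -- the `𝓗`-side: consecutive `Y`-sums from the companion faces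
    intro h hh
    obtain ⟨b₀, b₁, b₂, b₃, Ψ, hb₀, hb₁, hb₂, hb₃, hbin, s₀, s₁, s₂, s₃, n01, n12, n23, n30, n02, n13, hΨ, hFΨ⟩ := hHd h hh
    have hBsub : ({b₀, b₁, b₂, b₃} : Finset G) ⊆ T₀.1 \ T₁.1 := by
      intro x hx; simp only [mem_insert, mem_singleton] at hx
      rcases hx with rfl | rfl | rfl | rfl <;> assumption
    obtain ⟨p01, p12, p23, p30⟩ := orbit_consecutive_sums_companion c hc2 hcen T₀ T₁ hbase 4 hn hH _ hLrt hcover hP (le_refl _) Q' hQ' hQ'₁ hσH'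
      A' {b₀, b₁, b₂, b₃} hA'H hA'm hA't hBsub (cycle_stable c hc2 T₀ Q' (T₀.1 \ T₁.1) hHT₀ hb₀ hb₁ hb₂ hb₃ s₀ s₁ s₂ s₃) Ψ hΨ
      (by simp) (by simp) (by simp) (by simp) s₀ s₁ s₂ s₃ n01 n12 n23 n30 n02 n13 rfl hFΨ
    rcases hbin with rfl | rfl | rfl | rfl
    · exact ⟨b₁, b₂, b₃, hb₁, hb₂, hb₃, s₀, s₁, s₂, s₃, n02, n13, p01, p12, p23⟩
    · exact ⟨b₂, b₃, b₀, hb₂, hb₃, hb₀, s₁, s₂, s₃, s₀, n13, n02.symm, p12, p23, p30⟩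
    · exact ⟨b₃, b₀, b₁, hb₃, hb₀, hb₁, s₂, s₃, s₀, s₁, n02.symm, n13.symm, p23, p30, p01⟩
    · exact ⟨b₀, b₁, b₂, hb₀, hb₁, hb₂, s₃, s₀, s₁, s₂, n13.symm, n02, p30, p01, p12⟩
  · -- the `T₀ ∩ T₁`-side: consecutive `Y'`-sums from the orbit faces
    intro k hk
    obtain ⟨k₀, k₁, k₂, k₃, Φ', hk₀, hk₁, hk₂, hk₃, hkin, s₀, s₁, s₂, s₃, n01, n12, n23, n30, n02, n13, hΦ', hFΦ'⟩ := hC k hk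
    have hKsub : ({k₀, k₁, k₂, k₃} : Finset G) ⊆ T₀.1 \ (T₀.1 \ T₁.1) := by
      rw [hHc_eq]; intro x hx; simp only [mem_insert, mem_singleton] at hx
      rcases hx with rfl | rfl | rfl | rfl <;> assumption
    obtain ⟨p01, p12, p23, p30⟩ := orbit_consecutive_sums c hc2 hcen T₀ T₁ hbase 4 hn hH Q hQ hQ₁ hσH _ hLrt hcover (le_refl _)
      T {k₀, k₁, k₂, k₃} hTH hTm hT hKsub
      (by rw [hHc_eq]; exact cycle_stable c hc2 T₀ Q (T₀.1 ∩ T₁.1) hHcT₀ hk₀ hk₁ hk₂ hk₃ s₀ s₁ s₂ s₃) Φ' hΦ'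
      (by simp) (by simp) (by simp) (by simp) s₀ s₁ s₂ s₃ n01 n12 n23 n30 n02 n13 rfl hFΦ' hR
    rcases hkin with rfl | rfl | rfl | rfl
    · exact ⟨k₁, k₂, k₃, hk₁, hk₂, hk₃, s₀, s₁, s₂, s₃, n02, n13, p01, p12, p23⟩
    · exact ⟨k₂, k₃, k₀, hk₂, hk₃, hk₀, s₁, s₂, s₃, s₀, n13, n02.symm, p12, p23, p30⟩
    · exact ⟨k₃, k₀, k₁, hk₃, hk₀, hk₁, s₂, s₃, s₀, s₁, n02.symm, n13.symm, p23, p30, p01⟩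
    · exact ⟨k₀, k₁, k₂, hk₀, hk₁, hk₂, s₃, s₀, s₁, s₂, n13.symm, n02, p30, p01, p12⟩

end Frame

end

end Summit.HodgeConjecture.CorCM.Census.CentralSquares
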